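import Literature.MathematicalPhysics.QuantumFieldTheory.Balaban1983to89.Node00.CarriersB12Chart
import Literature.MathematicalPhysics.QuantumFieldTheory.Balaban1983to89.T4FixedPointResponse

/-!
# NODE N09 [B12] — THE SECT. C MAP OF (174): `T(Y) = Y − H D(Y)` ([15] (47)) — the SIX displayed `T`-hypotheses of the chart road (module D's
# `T_zero ∕ lip ∕ second`, the analyticity `hTa` of `…N09ChartLettersAnalytic`, the smoothing laws `lapT ∕ lapTlip` of `…N09ChartSecondOrderInputs`)
# DERIVED from print's two letters: the operator `H` of [5] (a continuous linear map, with ONE smoothing law) and `D` of (49) (second order, analytic)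

WIDTH SEAT `pub-ymgap-dag-n09-w1` (g0, 2026-08-28; HUMAN RULING D-0149; plan g77 `W-SEAT-START-LIST.md` §n09 ITEM 1, fourth field-file; key K1⁷ `stmt-QuantumFields-20542`,
`--supports`, COUNT-NEUTRAL helper).  APPEND-ONLY GROWTH: a NEW importing module; node00-def-B12 MODULE D `Node00/CarriersB12Chart` (`ChartB12Run`, `ChartB12Laws`), lit
`B13Contraction113.QuadAnalytic`, b2b `T4FixedPointResponse.quadAnalytic_norm_sub_le`, r20 `B12Eq311RemainderQuadratic.lapCur_*` CONSUMED BY NAME; nothing landed is edited.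

PRINT.  [15] = T. Bałaban, CMP **102** (1985): (47) p. 285 *«We will construct the linearizing transformation in the form A = A′ − HD(A′)»*; (174) p. 305
*«The configuration 𝓗 is represented as 𝓗 = 𝒜₁ + H₁B − HD(𝒜₁ + H₁B)»* — so the chart's outer map is `T(Y) = Y − HD(Y)`; p. 287 *«D(A′) … is an analytic function
of A′ for 𝔤ᶜ valued configurations A′ satisfying |A′|₍₋₁₎ < ε₃»*; (55) p. 286 (the quadratic bound of `D`); `H` = the operator of [5] (bounded between the spaces,
with the derivative bounds of [5] — the source of the `∂^{ξ*}π∂^ξ`-smoothing); (119)–(120) p. 295 (the Cauchy-estimate Lipschitz bound for a quadratic-analytic map).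

WHAT IS PROVED (kernel, sorry-free, theorems only).
§1 (generic, [15] Sect. C) for `H : 𝒳 →L[ℂ] 𝒴`, `D : 𝒴 → 𝒳` with `QuadAnalytic D C_D a_D` (‖DY‖ ≤ C_D‖Y‖² on ‖Y‖ < a_D, analytic along complex lines) and `T := Y ↦ Y − H(DY)`:
   `D_zero`, `sectC_zero` (`T0 = 0`), `sectC_sub_self` (`‖TY − Y‖ ≤ ‖H‖C_D‖Y‖²`), `sectC_lipschitz` (`‖Tx − Ty‖ ≤ (1 + ‖H‖·4C_D m)‖x − y‖` on `‖·‖ < m`, `2m ≤ a_D`),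
   `sectC_analyticOnNhd` (`T` analytic where `D` is); and for ANY additive functional `Φ` with a smoothing law `‖Φ(Hg)‖ ≤ B‖g‖`: `sectC_smooth_sub_self`
   (`‖Φ(TY − Y)‖ ≤ B C_D‖Y‖²`), `sectC_smooth_lipschitz` (`‖Φ((Tx − x) − (Ty − y))‖ ≤ B·4C_D m‖x − y‖`).
§2 AT A CHARTED RUN `χ` whose `T` IS the Sect. C map (`hT : ∀ Y, χ.T Y = Y − H (D Y)`): module D's three `T`-laws `T_zero_of_sectC ∕ second_of_sectC ∕ lip_of_sectC`
   (with `K_D := ‖H‖C_D`, `Klip := 1 + ‖H‖·4C_D(ε₄ + a)`), file 1's `hTa_of_sectC` (`AnalyticOnNhd ℂ χ.T {‖Y‖ < ε₄ + a}` from `D` analytic there) and file 3's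
   `lapT_of_sectC ∕ lapTlip_of_sectC` (with `K_L := B_{HH}C_D`, `K_L′ := B_{HH}·4C_D(ε₄ + a)`) from ONE displayed smoothing law `lapH` for `H` in the
   `∂^{ξ*}π∂^ξ ∘ ev`-currency — all for `2(ε₄ + a) ≤ a_D`.

HONEST SCOPE ∕ A6 (№189).  (a) What moved: six displayed hypotheses about the abstract `T` of the chart road are theorems once `T` has print's form (47)∕(174); what replaces them
are print's letters `H` (a CLM; its smoothing law `lapH` = [5]'s derivative bounds, N06∕N07 in-edge) and `D` (quadratic-analytic ∕ analytic on its ball, (55) + p. 287).  (b) What did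
NOT move: `H`, `D` have no tree object at NODE 00's objects; `χ.T` is a FIELD of the charted run, so `hT` is a hypothesis about the run's presentation, discharged by `rfl` the day a
run is BUILT with `T := fun Y => Y − H (D Y)`; N09 NOT discharged; counts unmoved (typed 28∕28 · discharged 5∕27); `Rz`-generic.  (c) Satisfiability: at `H = 0`, `D = 0` (with
`T = id`, module D's zero scheme) every hypothesis holds with `C_D = 0`, any `a_D ≥ 2(ε₄ + a)`, `B = 0` — physically vacuous sanity only.  One finite 𝕋⁴ programme at fixed
`ε = L^{−K}`, Bałaban AS PRINTED; the Yang–Mills mass gap (Clay) is NOT proved by any of this — R4 closes the conditional finite-𝕋⁴ rung `BalabanLadder.UV` only; nothing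
continuum ∕ ℝ⁴ ∕ infinite volume ∕ OS ∕ mass gap ∕ Clay.  No `sorry`, no `axiom`, no `def`, no `instance`, no `notation`.
-/

noncomputable section

namespace Summit.QuantumFields.YangMills.BalabanUVNodes.N09ChartSectCMap

open Metric Set
open Literature.MathematicalPhysics.QuantumFieldTheory.Balaban1983to89
open Literature.MathematicalPhysics.QuantumFieldTheory.Balaban1983to89.Node00
open B13Contraction113 (QuadAnalytic)
open B12Lemma4Models (slProj)
open B12Eq311CurrentExpansion (lapCur)
open B12Eq311RemainderQuadratic (lapCur_add lapCur_smul lapCur_sub)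
open T4FixedPointResponse (quadAnalytic_norm_sub_le)
open scoped Matrix.Norms.L2Operator

/-! ## §1. [15] Sect. C, generic: `T(Y) = Y − H D(Y)` with `H` a continuous linear map and `D` quadratic-analytic -/

section Generic

variable {𝒳 𝒴 : Type*} [NormedAddCommGroup 𝒳] [NormedSpace ℂ 𝒳] [NormedAddCommGroup 𝒴] [NormedSpace ℂ 𝒴]
  (H : 𝒳 →L[ℂ] 𝒴) {D : 𝒴 → 𝒳} {C_D a_D : ℝ}

/-- `D(0) = 0` — a quadratic bound `‖DY‖ ≤ C_D‖Y‖²` on a ball of positive radius forces it. [cite: Balaban1985Variational, (55) p.286] -/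
theorem D_zero (hD : QuadAnalytic D C_D a_D) (ha : 0 < a_D) : D 0 = 0 := by
  have h := hD.quad 0 (by simpa using ha)
  rw [norm_zero] at h
  exact norm_le_zero_iff.1 (h.trans (by simp))

/-- **`T(0) = 0`** for `T(Y) = Y − HD(Y)` (module D's law `T_zero` in print's form). [cite: Balaban1985Variational, (47) p.285, (174) p.305] -/
theorem sectC_zero (hD : QuadAnalytic D C_D a_D) (ha : 0 < a_D) : (0 : 𝒴) - H (D 0) = 0 := by
  rw [D_zero hD ha, map_zero, sub_zero]

/-- **`T − id` IS OF SECOND ORDER**: `‖(Y − HD(Y)) − Y‖ = ‖H(DY)‖ ≤ ‖H‖·C_D·‖Y‖²` on `‖Y‖ < a_D` (module D's law `second`, (177)'s mechanism).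
[cite: Balaban1985Variational, (47) p.285, (55) p.286, (177) p.306] -/
theorem sectC_sub_self (hD : QuadAnalytic D C_D a_D) {Y : 𝒴} (hY : ‖Y‖ < a_D) : ‖(Y - H (D Y)) - Y‖ ≤ ‖H‖ * C_D * ‖Y‖ ^ 2 := by
  rw [sub_sub_cancel_left, norm_neg]
  calc ‖H (D Y)‖ ≤ ‖H‖ * ‖D Y‖ := H.le_opNorm _
    _ ≤ ‖H‖ * (C_D * ‖Y‖ ^ 2) := mul_le_mul_of_nonneg_left (hD.quad Y hY) (norm_nonneg _)
    _ = ‖H‖ * C_D * ‖Y‖ ^ 2 := by ring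

/-- **`T` IS LIPSCHITZ ON THE BALL**: `‖(x − HD(x)) − (y − HD(y))‖ ≤ (1 + ‖H‖·4C_D m)‖x − y‖` for `‖x‖, ‖y‖ < m`, `2m ≤ a_D` (module D's law `lip`; the Cauchy-estimate
bound (119)–(120) for `D`, b2b's `quadAnalytic_norm_sub_le` BY NAME). [cite: Balaban1985Variational, (47) p.285, (119)-(120) p.295] -/
theorem sectC_lipschitz (hD : QuadAnalytic D C_D a_D) (hC : 0 ≤ C_D) {m : ℝ} (hm : 2 * m ≤ a_D) {x y : 𝒴} (hx : ‖x‖ < m) (hy : ‖y‖ < m) :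
    ‖(x - H (D x)) - (y - H (D y))‖ ≤ (1 + ‖H‖ * (4 * C_D * m)) * ‖x - y‖ := by
  have hDd := quadAnalytic_norm_sub_le hD hC hm hx hy
  have e : (x - H (D x)) - (y - H (D y)) = (x - y) - H (D x - D y) := by rw [map_sub]; abel
  rw [e, add_mul, one_mul]
  refine (norm_sub_le _ _).trans (add_le_add le_rfl ?_)
  calc ‖H (D x - D y)‖ ≤ ‖H‖ * ‖D x - D y‖ := H.le_opNorm _
    _ ≤ ‖H‖ * (4 * C_D * m * ‖x - y‖) := mul_le_mul_of_nonneg_left hDd (norm_nonneg _)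
    _ = ‖H‖ * (4 * C_D * m) * ‖x - y‖ := by ring

/-- **`T` IS ANALYTIC WHERE `D` IS** (p. 287 «D(A′) … is an analytic function of A′»; `H` linear continuous). [cite: Balaban1985Variational, p.287, (47) p.285] -/
theorem sectC_analyticOnNhd {S : Set 𝒴} (hDa : AnalyticOnNhd ℂ D S) : AnalyticOnNhd ℂ (fun Y => Y - H (D Y)) S :=
  fun Y hY => analyticAt_id.sub ((H.analyticAt _).fun_comp (hDa Y hY))

variable {G : Type*} [SeminormedAddCommGroup G] (Φ : 𝒴 →+ G) {B : ℝ}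

/-- **SMOOTHING, SECOND ORDER**: for an additive functional `Φ` with `‖Φ(Hg)‖ ≤ B‖g‖` (the `∂^{ξ*}π∂^ξ`-reading of [5]'s derivative bounds for `H`): `‖Φ(TY − Y)‖ ≤ B·C_D·‖Y‖²`
on `‖Y‖ < a_D` (file 3's law `lapT`). [cite: Balaban1985Variational, (47) p.285, (55) p.286] -/
theorem sectC_smooth_sub_self (hD : QuadAnalytic D C_D a_D) (hB : 0 ≤ B) (hΦ : ∀ g : 𝒳, ‖Φ (H g)‖ ≤ B * ‖g‖) {Y : 𝒴} (hY : ‖Y‖ < a_D) :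
    ‖Φ ((Y - H (D Y)) - Y)‖ ≤ B * C_D * ‖Y‖ ^ 2 := by
  rw [sub_sub_cancel_left, map_neg, norm_neg]
  calc ‖Φ (H (D Y))‖ ≤ B * ‖D Y‖ := hΦ _
    _ ≤ B * (C_D * ‖Y‖ ^ 2) := mul_le_mul_of_nonneg_left (hD.quad Y hY) hB
    _ = B * C_D * ‖Y‖ ^ 2 := by ring

/-- **SMOOTHING, LIPSCHITZ**: `‖Φ((Tx − x) − (Ty − y))‖ = ‖Φ(H(Dy − Dx))‖ ≤ B·4C_D m·‖x − y‖` for `‖x‖, ‖y‖ < m`, `2m ≤ a_D` (file 3's law `lapTlip`).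
[cite: Balaban1985Variational, (47) p.285, (119)-(120) p.295] -/
theorem sectC_smooth_lipschitz (hD : QuadAnalytic D C_D a_D) (hC : 0 ≤ C_D) (hB : 0 ≤ B) (hΦ : ∀ g : 𝒳, ‖Φ (H g)‖ ≤ B * ‖g‖) {m : ℝ} (hm : 2 * m ≤ a_D)
    {x y : 𝒴} (hx : ‖x‖ < m) (hy : ‖y‖ < m) : ‖Φ (((x - H (D x)) - x) - ((y - H (D y)) - y))‖ ≤ B * (4 * C_D * m) * ‖x - y‖ := by
  have hDd := quadAnalytic_norm_sub_le hD hC hm hx hy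
  have e : ((x - H (D x)) - x) - ((y - H (D y)) - y) = -(H (D x - D y)) := by rw [map_sub]; abel
  rw [e, map_neg, norm_neg]
  calc ‖Φ (H (D x - D y))‖ ≤ B * ‖D x - D y‖ := hΦ _
    _ ≤ B * (4 * C_D * m * ‖x - y‖) := mul_le_mul_of_nonneg_left hDd hB
    _ = B * (4 * C_D * m) * ‖x - y‖ := by ring

end Generic

/-! ## §2. At a charted run whose outer map IS the Sect. C map: the six displayed `T`-hypotheses of the chart road -/

section Pin

variable {P : Params} {N M : ℕ} {𝒴 𝒵 𝒳 : Type} [NormedAddCommGroup 𝒴] [NormedSpace ℂ 𝒴] [NormedAddCommGroup 𝒵] [NormedSpace ℂ 𝒵]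
  [NormedAddCommGroup 𝒳] [NormedSpace ℂ 𝒳]
  {cB : ℝ} {χ : ChartB12Run P N M 𝒴 𝒵} {H : 𝒳 →L[ℂ] 𝒴} {D : 𝒴 → 𝒳} {C_D a_D : ℝ}

/-- The functional `Y ↦ ∂^{ξ*}π∂^ξ(ev Y)(b)` is additive (r20's `lapCur_add` + linearity of the presentation). [cite: Balaban1987RG1, (3.11) p.272 (bookkeeping)] -/
theorem lapCur_ev_add' (ξ : ℝ) (b : PBond P 0) (Y Y' : 𝒴) :
    lapCur (slProj N) ξ (1 : PBond P 0 → (MatA N)ˣ) (χ.ev (Y + Y')) b =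
      lapCur (slProj N) ξ (1 : PBond P 0 → (MatA N)ˣ) (χ.ev Y) b + lapCur (slProj N) ξ (1 : PBond P 0 → (MatA N)ˣ) (χ.ev Y') b := by
  rw [map_add, lapCur_add]

/-- **Module D's `T_zero` from (47).** [cite: Balaban1985Variational, (47) p.285, (174) p.305] -/
theorem T_zero_of_sectC (hT : ∀ Y, χ.T Y = Y - H (D Y)) (hD : QuadAnalytic D C_D a_D) (ha : 0 < a_D) : χ.T 0 = 0 := by
  rw [hT]; exact sectC_zero H hD ha

/-- **Module D's `second` from (47)** with `K_D := ‖H‖·C_D`, for `ε₄ + a ≤ a_D`. [cite: Balaban1985Variational, (47) p.285, (55) p.286, (177) p.306] -/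
theorem second_of_sectC (hT : ∀ Y, χ.T Y = Y - H (D Y)) (hD : QuadAnalytic D C_D a_D) (hdom : χ.ε₄ + χ.a ≤ a_D) :
    ∀ Y : 𝒴, ‖Y‖ < χ.ε₄ + χ.a → ‖χ.T Y - Y‖ ≤ (‖H‖ * C_D) * ‖Y‖ ^ 2 := fun Y hY => by
  rw [hT]; exact sectC_sub_self H hD (hY.trans_le hdom)

/-- **Module D's `lip` from (47)** with `Klip := 1 + ‖H‖·4C_D(ε₄ + a)`, for `2(ε₄ + a) ≤ a_D`. [cite: Balaban1985Variational, (47) p.285, (119)-(120) p.295] -/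
theorem lip_of_sectC (hT : ∀ Y, χ.T Y = Y - H (D Y)) (hD : QuadAnalytic D C_D a_D) (hC : 0 ≤ C_D) (hdom : 2 * (χ.ε₄ + χ.a) ≤ a_D) :
    ∀ x y : 𝒴, ‖x‖ < χ.ε₄ + χ.a → ‖y‖ < χ.ε₄ + χ.a → ‖χ.T x - χ.T y‖ ≤ (1 + ‖H‖ * (4 * C_D * (χ.ε₄ + χ.a))) * ‖x - y‖ := fun x y hx hy => by
  rw [hT, hT]; exact sectC_lipschitz H hD hC hdom hx hy

/-- **File 1's `hTa` from (47)**: `χ.T` is analytic on `‖Y‖ < ε₄ + a` when `D` is (p. 287). [cite: Balaban1985Variational, p.287, (47) p.285] -/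
theorem hTa_of_sectC (hT : ∀ Y, χ.T Y = Y - H (D Y)) (hDa : AnalyticOnNhd ℂ D {Y : 𝒴 | ‖Y‖ < χ.ε₄ + χ.a}) :
    AnalyticOnNhd ℂ χ.T {Y : 𝒴 | ‖Y‖ < χ.ε₄ + χ.a} := by
  have e : χ.T = fun Y => Y - H (D Y) := funext hT
  rw [e]; exact sectC_analyticOnNhd H hDa

/-- **File 3's `lapT` from (47) and ONE smoothing law for `H`** (`lapH`: `‖∂^{ξ*}π∂^ξ ev(Hg)(b)‖ ≤ B_{HH}‖g‖`, [5]'s derivative bounds for the operator `H`):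
`‖∂^{ξ*}π∂^ξ ev(TY − Y)(b)‖ ≤ B_{HH}·C_D·‖Y‖²` on the ball. [cite: Balaban1985Variational, (47) p.285, (55) p.286; Balaban1987RG1, p.279 («for the second order operator»)] -/
theorem lapT_of_sectC (hT : ∀ Y, χ.T Y = Y - H (D Y)) (hD : QuadAnalytic D C_D a_D) (hdom : χ.ε₄ + χ.a ≤ a_D) {BHH : ℝ} (hBHH : 0 ≤ BHH)
    (lapH : ∀ (g : 𝒳) (b : PBond P 0), ‖lapCur (slProj N) (χ.toResid.csX cB).ξ (1 : PBond P 0 → (MatA N)ˣ) (χ.ev (H g)) b‖ ≤ BHH * ‖g‖) :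
    ∀ Y : 𝒴, ‖Y‖ < χ.ε₄ + χ.a → ∀ b : PBond P 0,
      ‖lapCur (slProj N) (χ.toResid.csX cB).ξ (1 : PBond P 0 → (MatA N)ˣ) (χ.ev (χ.T Y - Y)) b‖ ≤ (BHH * C_D) * ‖Y‖ ^ 2 := by
  intro Y hY b
  let Φ : 𝒴 →+ MatA N :=
    { toFun := fun Z => lapCur (slProj N) (χ.toResid.csX cB).ξ (1 : PBond P 0 → (MatA N)ˣ) (χ.ev Z) b
      map_zero' := by simp only [map_zero]; exact B12CondIIIJConcreteModels.lapCur_zero _ _ _ _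
      map_add' := fun Z Z' => lapCur_ev_add' _ b Z Z' }
  have h := sectC_smooth_sub_self H Φ hD hBHH (fun g => lapH g b) (hY.trans_le hdom)
  rw [hT]
  exact h

/-- **File 3's `lapTlip` from (47) and the smoothing law for `H`**: `‖∂^{ξ*}π∂^ξ ev((Tx − x) − (Ty − y))(b)‖ ≤ B_{HH}·4C_D(ε₄ + a)·‖x − y‖` for `2(ε₄ + a) ≤ a_D`.
[cite: Balaban1985Variational, (47) p.285, (119)-(120) p.295, (190) p.308] -/
theorem lapTlip_of_sectC (hT : ∀ Y, χ.T Y = Y - H (D Y)) (hD : QuadAnalytic D C_D a_D) (hC : 0 ≤ C_D) (hdom : 2 * (χ.ε₄ + χ.a) ≤ a_D)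
    {BHH : ℝ} (hBHH : 0 ≤ BHH)
    (lapH : ∀ (g : 𝒳) (b : PBond P 0), ‖lapCur (slProj N) (χ.toResid.csX cB).ξ (1 : PBond P 0 → (MatA N)ˣ) (χ.ev (H g)) b‖ ≤ BHH * ‖g‖) :
    ∀ x y : 𝒴, ‖x‖ < χ.ε₄ + χ.a → ‖y‖ < χ.ε₄ + χ.a → ∀ b : PBond P 0,
      ‖lapCur (slProj N) (χ.toResid.csX cB).ξ (1 : PBond P 0 → (MatA N)ˣ) (χ.ev ((χ.T x - x) - (χ.T y - y))) b‖ ≤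
        (BHH * (4 * C_D * (χ.ε₄ + χ.a))) * ‖x - y‖ := by
  intro x y hx hy b
  let Φ : 𝒴 →+ MatA N :=
    { toFun := fun Z => lapCur (slProj N) (χ.toResid.csX cB).ξ (1 : PBond P 0 → (MatA N)ˣ) (χ.ev Z) b
      map_zero' := by simp only [map_zero]; exact B12CondIIIJConcreteModels.lapCur_zero _ _ _ _
      map_add' := fun Z Z' => lapCur_ev_add' _ b Z Z' }
  have h := sectC_smooth_lipschitz H Φ hD hC hBHH (fun g => lapH g b) hdom hx hy
  rw [hT, hT]
  exact h

end Pin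

end Summit.QuantumFields.YangMills.BalabanUVNodes.N09ChartSectCMap

end
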